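import Mathlib
import HarnessLib
import Summits.NavierStokesRegularity.NavierStokesRegularity.Theorems.LoopPeriodRatchetNoPlanarExtremumSard
import Summits.NavierStokesRegularity.NavierStokesRegularity.Theorems.PoloidalWindowDoorPoloidalWindowRigidityHotLoopLevel
import Summits.NavierStokesRegularity.NavierStokesRegularity.Theorems.PoloidalWindowDoorPoloidalWindowRigidityNullCharts

/-!
# Route `PoloidalWindowDoor`, crux `PoloidalWindowRigidity` (K2, stmt-NavierStokesRegularity-19708) — HOT ISLANDS OR DEAD
# PLANES: the topological core of stub HP1 `stub_islandOrNull` (line `hot_loops` v2, ns-idea-8 g6)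

Cell ns-regularity-ideate, seat ns-poloidal-K2-p2 g11 (stub-worker on K2; `--supports` the crux item).

Abstract setting: `X ∈ C²(ℝ³, ℝ³)` horizontal with a `C¹` planar stream function `G` (`∂₀G = −X₁`, `∂₁G = X₀`), `f ∈ C³`
a first integral of `X` (`Df(X) ≡ 0`), an isolated compact hot piece `K ∋ y₀` of the top level `N` of `f` on the plane
through `y₀` inside an open `O` (`f ≤ N` on `O ∩ plane`, `{f = N} ∩ O ∩ plane ⊆ K`).  **`loop_or_nullDisc`**: EITHER
`y′ = X(y)` has a non-stationary periodic orbit, OR `X` vanishes on a planar disc of that plane.  Proof: collar and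
level points as in `…HotLoopCore`; if some regular level `c` just below `N` has its inner piece free of zeros of `X`,
`…HotLoopLevel.exists_periodic_orbit_of_hot_level` gives the loop; otherwise every level in an interval `J` carries a
planar zero of `X` or a critical point of `f`; the compact set of such points maps ONTO `J`; its critical part has
nowhere dense image (tree Sard substitute `…Sard.exists_regular_level`), so by Baire (`…NullCharts.exists_Ioo_subset_of_closed_cover`)
over a countable cover by null charts (`…NullCharts.exists_nullChart`: zeros of `X` ⇔ `κ(f) = 0` locally) one chart's
`κ` vanishes on a level interval, and `X` vanishes on an open planar set.

WHAT THIS IS NOT: not a claim about Navier–Stokes — planar topology (Liouville–Arnold, one degree of freedom) for one stub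
of an ideator line of a door route (bears_on LADDER-NS N0, rung N0-LocalTubeDoorPoloidal).
-/

noncomputable section

-- the summit and its single sub-problem share the name (CONVENTIONS §1), as in every Theorems file
set_option linter.dupNamespace false

namespace Summit.NavierStokesRegularity.NavierStokesRegularity.Theorems.PoloidalWindowDoorPoloidalWindowRigidityIslandOrNullCore

open Set Function Filter Topology Metric
open Summit.NavierStokesRegularity.NavierStokesRegularity.Theorems.LoopPeriodRatchetNoPlanarExtremumSard
open Summit.NavierStokesRegularity.NavierStokesRegularity.Theorems.PoloidalWindowDoorPoloidalWindowRigidityHotLoopPrelim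
open Summit.NavierStokesRegularity.NavierStokesRegularity.Theorems.PoloidalWindowDoorPoloidalWindowRigidityHotLoopLevel
open Summit.NavierStokesRegularity.NavierStokesRegularity.Theorems.PoloidalWindowDoorPoloidalWindowRigidityNullCharts

/-- **Hot islands or dead planes.**  See the module docstring. -/
theorem loop_or_nullDisc
    {X : EuclideanSpace ℝ (Fin 3) → EuclideanSpace ℝ (Fin 3)} (hX : ContDiff ℝ 2 X) (hX2 : ∀ y, X y 2 = 0)
    {f : EuclideanSpace ℝ (Fin 3) → ℝ} (hf : ContDiff ℝ 3 f) (hfX : ∀ y, fderiv ℝ f y (X y) = 0)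
    {G : EuclideanSpace ℝ (Fin 3) → ℝ} (hG : ContDiff ℝ 1 G)
    (hG0 : ∀ y, fderiv ℝ G y (EuclideanSpace.single 0 1) = -(X y 1))
    (hG1 : ∀ y, fderiv ℝ G y (EuclideanSpace.single 1 1) = X y 0)
    {N : ℝ} {y₀ : EuclideanSpace ℝ (Fin 3)}
    {K O : Set (EuclideanSpace ℝ (Fin 3))} (hK : IsCompact K) (hy₀ : y₀ ∈ K)
    (hKf : ∀ y ∈ K, y 2 = y₀ 2 ∧ f y = N) (hO : IsOpen O) (hKO : K ⊆ O)
    (hfle : ∀ y : EuclideanSpace ℝ (Fin 3), y 2 = y₀ 2 → y ∈ O → f y ≤ N)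
    (hiso : ∀ y ∈ O, y 2 = y₀ 2 → f y = N → y ∈ K) :
    (∃ (γ : ℝ → EuclideanSpace ℝ (Fin 3)) (ℓ : ℝ), 0 < ℓ ∧ (∀ θ, HasDerivAt γ (X (γ θ)) θ) ∧
      (∀ θ, γ (θ + ℓ) = γ θ) ∧ X (γ 0) ≠ 0) ∨
    (∃ (y₁ : EuclideanSpace ℝ (Fin 3)) (r : ℝ), y₁ 2 = y₀ 2 ∧ 0 < r ∧
      ∀ y : EuclideanSpace ℝ (Fin 3), y 2 = y₀ 2 → dist y y₁ < r → X y = 0) := by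
  have hKne : K.Nonempty := ⟨y₀, hy₀⟩
  have hKc : IsClosed K := hK.isClosed
  have hf2 : ContDiff ℝ 2 f := hf.of_le (by norm_num)
  have hf1 : ContDiff ℝ 1 f := hf.of_le (by norm_num)
  have hfd : Differentiable ℝ f := hf1.differentiable one_ne_zero
  have hfc : Continuous f := hf.continuous
  set d : EuclideanSpace ℝ (Fin 3) → ℝ := fun y => infDist y K with hd
  have hdc : Continuous d := continuous_infDist_pt K
  have hd0 : ∀ y ∈ K, d y = 0 := fun y hy => infDist_zero_of_mem hy
  -- (a) the scale `u`: `cthickening (10u) K ⊆ O`, and a radius `R₀` for `K`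
  obtain ⟨δ, hδ, hδO⟩ := hK.exists_cthickening_subset_open hO hKO
  set u : ℝ := δ / 10 with hu
  have hu0 : 0 < u := by positivity
  have hinO : ∀ y, d y ≤ 9 * u → y ∈ O := fun y hy => by
    refine hδO (thickening_subset_cthickening δ K ((mem_thickening_iff_infDist_lt hKne).2 ?_))
    show infDist y K < δ
    have : d y < δ := by rw [hu] at hy; linarith
    exact this
  obtain ⟨R₀, hKR⟩ := hK.isBounded.subset_closedBall y₀
  have hR₀ : 0 ≤ R₀ := by
    have h := hKR hy₀
    rw [mem_closedBall, dist_self] at h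
    exact h
  set e0 : EuclideanSpace ℝ (Fin 3) := EuclideanSpace.single 0 1 with he0
  set e1 : EuclideanSpace ℝ (Fin 3) := EuclideanSpace.single 1 1 with he1
  set e2 : EuclideanSpace ℝ (Fin 3) := EuclideanSpace.single 2 1 with he2
  have hne0 : ‖e0‖ = 1 := by simp [he0]
  -- (b) the collar `A = {u/2 ≤ d ≤ 9u} ∩ plane` and its maximum `μ₁ < N`
  set A : Set (EuclideanSpace ℝ (Fin 3)) := {y | y 2 = y₀ 2 ∧ u / 2 ≤ d y ∧ d y ≤ 9 * u} with hA
  have hplane_closed : IsClosed {y : EuclideanSpace ℝ (Fin 3) | y 2 = y₀ 2} :=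
    isClosed_eq (EuclideanSpace.proj (2 : Fin 3)).continuous continuous_const
  have hAclosed : IsClosed A := by
    rw [hA, Set.setOf_and, Set.setOf_and]
    exact hplane_closed.inter ((isClosed_le continuous_const hdc).inter (isClosed_le hdc continuous_const))
  have hAbdd : A ⊆ closedBall y₀ (R₀ + (9 * u + 1)) := fun y hy =>
    mem_closedBall.2 (dist_lt_of_infDist_lt hKne hKR (by linarith [hy.2.2] : d y < 9 * u + 1)).le
  have hAc : IsCompact A := (isCompact_closedBall y₀ _).of_isClosed_subset hAclosed hAbdd
  have hAlt : ∀ y ∈ A, f y < N := by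
    intro y hy
    have hyO : y ∈ O := hinO y hy.2.2
    have hyK : y ∉ K := fun h => by have := hd0 y h; linarith [hy.2.1]
    exact lt_of_le_of_ne (hfle y hy.1 hyO) fun h => hyK (hiso y hyO hy.1 h)
  -- the first exit of the ray `y₀ + s•e0` from `{d < u/2}` gives a point of `A`
  set g : ℝ → ℝ := fun s => d (y₀ + s • e0) with hg
  have hgc : Continuous g := hdc.comp (by fun_prop)
  have hg0 : g 0 < u / 2 := by
    have : g 0 = 0 := by simp only [hg, zero_smul, add_zero]; exact hd0 y₀ hy₀
    rw [this]; positivity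
  have hgS : u / 2 ≤ g (R₀ + u / 2) := le_infDist_ray hKne hne0 hKR
  obtain ⟨s₁, hs₁0, -, hgs₁, hbefore⟩ := exists_first_exit hgc (by linarith) hg0 hgS
  set q : EuclideanSpace ℝ (Fin 3) := y₀ + s₁ • e0 with hq
  have hq2 : q 2 = y₀ 2 := by simp [hq, he0]
  have hqA : q ∈ A := ⟨hq2, by rw [← hgs₁], by rw [show d q = g s₁ from rfl, hgs₁]; linarith⟩
  obtain ⟨a, haA, hamax⟩ := hAc.exists_isMaxOn ⟨q, hqA⟩ hfc.continuousOn
  set μ₁ : ℝ := f a with hμ₁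
  have hμ₁N : μ₁ < N := hAlt a haA
  have hAle : ∀ y ∈ A, f y ≤ μ₁ := fun y hy => hamax hy
  -- (c) the Hamiltonian field of `f` for the Sard substitute, and level points for every `c ∈ (μ₁, N)`
  set Xf : EuclideanSpace ℝ (Fin 3) → EuclideanSpace ℝ (Fin 3) :=
    fun y => fderiv ℝ f y e1 • e0 + (-fderiv ℝ f y e0) • e1 with hXf
  have hXfc : ContDiff ℝ 2 Xf := by
    have h0 : ContDiff ℝ 2 fun y => fderiv ℝ f y e0 := (hf.fderiv_right (m := 2) (by norm_num)).clm_apply contDiff_const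
    have h1 : ContDiff ℝ 2 fun y => fderiv ℝ f y e1 := (hf.fderiv_right (m := 2) (by norm_num)).clm_apply contDiff_const
    exact (h1.smul contDiff_const).add (h0.neg.smul contDiff_const)
  have hXf0 : ∀ y, Xf y 0 = fderiv ℝ f y e1 := fun y => by simp [hXf, he0, he1]
  have hXf1 : ∀ y, Xf y 1 = -fderiv ℝ f y e0 := fun y => by simp [hXf, he0, he1]
  have hψ0 : ∀ y, fderiv ℝ f y (EuclideanSpace.single 0 1) = -(Xf y 1) := fun y => by rw [hXf1, neg_neg]
  have hψ1 : ∀ y, fderiv ℝ f y (EuclideanSpace.single 1 1) = Xf y 0 := fun y => (hXf0 y).symm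
  have hpt : ∀ c ∈ Ioo μ₁ N, ∃ p : EuclideanSpace ℝ (Fin 3), p 2 = y₀ 2 ∧ d p < u / 2 ∧ f p = c := by
    intro c hc
    set F : ℝ → ℝ := fun s => f (y₀ + s • e0) with hF
    have hFc : Continuous F := hfc.comp (by fun_prop)
    have hF0 : F 0 = N := by simp only [hF, zero_smul, add_zero]; exact (hKf y₀ hy₀).2
    have hF1 : F s₁ ≤ μ₁ := hAle q hqA
    obtain ⟨s₂, hs₂, hFs₂⟩ : c ∈ F '' Icc 0 s₁ :=
      intermediate_value_Icc' hs₁0.le hFc.continuousOn ⟨by linarith [hc.1], by rw [hF0]; exact hc.2.le⟩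
    have hs₂lt : s₂ < s₁ := by
      rcases hs₂.2.lt_or_eq with h | h
      · exact h
      · exfalso; rw [h] at hFs₂; linarith [hc.1]
    exact ⟨y₀ + s₂ • e0, by simp [he0], hbefore s₂ hs₂.1 hs₂lt, hFs₂⟩
  have hcollar : ∀ c, μ₁ < c → ∀ y : EuclideanSpace ℝ (Fin 3), y 2 = y₀ 2 → u / 2 ≤ infDist y K →
      infDist y K ≤ 9 * u → f y < c := fun c hc y hy2 hy1 hy3 => lt_of_le_of_lt (hAle y ⟨hy2, hy1, hy3⟩) hc
  -- (d) the dichotomy on a zero-free regular inner level piece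
  by_cases hgood : ∃ c ∈ Ioo μ₁ N, ∀ z : EuclideanSpace ℝ (Fin 3), z 2 = y₀ 2 → infDist z K < u / 2 → f z = c →
      (fderiv ℝ f z (EuclideanSpace.single 0 1) ≠ 0 ∨ fderiv ℝ f z (EuclideanSpace.single 1 1) ≠ 0) ∧ X z ≠ 0
  · left
    obtain ⟨c, hc, hregc⟩ := hgood
    obtain ⟨p, hp2, hpd, hpf⟩ := hpt c hc
    exact exists_periodic_orbit_of_hot_level hX hX2 hf1 hfX hKne hKR hu0 (hcollar c hc.1) hp2 hpd hpf hregc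
  right
  -- every level in `(μ₁, N)` carries a zero of `X` or a critical point of `f` on its inner piece
  have hbad : ∀ c ∈ Ioo μ₁ N, ∃ z : EuclideanSpace ℝ (Fin 3), z 2 = y₀ 2 ∧ infDist z K < u / 2 ∧ f z = c ∧
      (X z = 0 ∨ (fderiv ℝ f z (EuclideanSpace.single 0 1) = 0 ∧ fderiv ℝ f z (EuclideanSpace.single 1 1) = 0)) := by
    intro c hc
    by_contra hcon
    refine hgood ⟨c, hc, fun z hz2 hzd hzf => ?_⟩
    by_contra hneg
    refine hcon ⟨z, hz2, hzd, hzf, ?_⟩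
    by_cases hXz : X z = 0
    · exact Or.inl hXz
    · right
      by_contra hcr
      exact hneg ⟨by
        by_contra hnn
        simp only [not_or, not_ne_iff] at hnn
        exact hcr hnn, hXz⟩
  -- the level interval `J = [c₁, c₂]` and the compact set `N'` of bad points over it
  set c₁ : ℝ := (2 * μ₁ + N) / 3 with hc₁
  set c₂ : ℝ := (μ₁ + 2 * N) / 3 with hc₂
  have hc₁μ : μ₁ < c₁ := by rw [hc₁]; linarith
  have hc₁₂ : c₁ < c₂ := by rw [hc₁, hc₂]; linarith
  have hc₂N : c₂ < N := by rw [hc₂]; linarith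
  set Crit : Set (EuclideanSpace ℝ (Fin 3)) :=
    {z | fderiv ℝ f z (EuclideanSpace.single 0 1) = 0 ∧ fderiv ℝ f z (EuclideanSpace.single 1 1) = 0} with hCrit
  set N' : Set (EuclideanSpace ℝ (Fin 3)) :=
    {z | z 2 = y₀ 2 ∧ d z ≤ u / 2 ∧ f z ∈ Icc c₁ c₂ ∧ (X z = 0 ∨ z ∈ Crit)} with hN'
  have hXc : Continuous X := hX.continuous
  have hf0c : Continuous fun z => fderiv ℝ f z (EuclideanSpace.single 0 1) :=
    (hf1.continuous_fderiv one_ne_zero).clm_apply continuous_const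
  have hf1c : Continuous fun z => fderiv ℝ f z (EuclideanSpace.single 1 1) :=
    (hf1.continuous_fderiv one_ne_zero).clm_apply continuous_const
  have hCritc : IsClosed Crit := by
    rw [hCrit, setOf_and]
    exact (isClosed_eq hf0c continuous_const).inter (isClosed_eq hf1c continuous_const)
  have hplane_closed : IsClosed {y : EuclideanSpace ℝ (Fin 3) | y 2 = y₀ 2} :=
    isClosed_eq (EuclideanSpace.proj (2 : Fin 3)).continuous continuous_const
  have hN'closed : IsClosed N' := by
    rw [hN', setOf_and, setOf_and, setOf_and]
    refine hplane_closed.inter ((isClosed_le hdc continuous_const).inter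
      ((isClosed_Icc.preimage hfc).inter ?_))
    rw [setOf_or]
    exact (isClosed_eq hXc continuous_const).union hCritc
  have hN'bdd : N' ⊆ closedBall y₀ (R₀ + u) := fun y hy =>
    mem_closedBall.2 (dist_lt_of_infDist_lt hKne hKR (by linarith [hy.2.1] : d y < u)).le
  have hN'c : IsCompact N' := (isCompact_closedBall y₀ _).of_isClosed_subset hN'closed hN'bdd
  have hN'surj : ∀ c ∈ Ioo c₁ c₂, ∃ z ∈ N', f z = c ∧ infDist z K < u / 2 := by
    intro c hc
    obtain ⟨z, hz2, hzd, hzf, hz⟩ := hbad c ⟨by linarith [hc.1], by linarith [hc.2]⟩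
    exact ⟨z, ⟨hz2, hzd.le, by rw [hzf]; exact ⟨hc.1.le, hc.2.le⟩, hz⟩, hzf, hzd⟩
  -- null charts at the regular bad points
  set Nreg : Set (EuclideanSpace ℝ (Fin 3)) := N' \ Crit with hNreg
  have hchart : ∀ z ∈ Nreg, ∃ (κ : ℝ → ℝ) (r : ℝ), 0 < r ∧ ∀ y : EuclideanSpace ℝ (Fin 3), dist y z < 2 * r →
      y 2 = z 2 → (X y = 0 ↔ κ (f y) = 0) ∧
        (fderiv ℝ f y (EuclideanSpace.single 0 1) ≠ 0 ∨ fderiv ℝ f y (EuclideanSpace.single 1 1) ≠ 0) := by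
    intro z hz
    have hzreg : fderiv ℝ f z (EuclideanSpace.single 0 1) ≠ 0 ∨ fderiv ℝ f z (EuclideanSpace.single 1 1) ≠ 0 := by
      by_contra h
      simp only [not_or, not_ne_iff] at h
      exact hz.2 h
    obtain ⟨κ, U, hU, hprop⟩ := exists_nullChart hX2 hf1 hG hG0 hG1 hfX hzreg
    obtain ⟨ρ, hρ, hball⟩ := Metric.mem_nhds_iff.1 hU
    refine ⟨κ, ρ / 2, by positivity, fun y hy hy2 => hprop y (hball ?_) hy2⟩
    rw [mem_ball]; linarith
  choose! κ r hr using hchart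
  -- a countable subcover of `Nreg` by the inner balls
  obtain ⟨T, hTcount, hTcov⟩ :=
    TopologicalSpace.isOpen_iUnion_countable (fun z : Nreg => ball (z : EuclideanSpace ℝ (Fin 3)) (r z))
      (fun _ => isOpen_ball)
  have hcovreg : ∀ z ∈ Nreg, ∃ t ∈ T, z ∈ ball (t : EuclideanSpace ℝ (Fin 3)) (r t) := by
    intro z hz
    have hzmem : z ∈ ⋃ w : Nreg, ball (w : EuclideanSpace ℝ (Fin 3)) (r w) :=
      mem_iUnion.2 ⟨⟨z, hz⟩, mem_ball_self (hr z hz).1⟩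
    rw [← hTcov] at hzmem
    simpa only [mem_iUnion, exists_prop] using hzmem
  -- Baire over the images
  haveI : Countable T := hTcount.to_subtype
  set S : Option T → Set ℝ := fun j =>
    j.elim (f '' (N' ∩ Crit)) fun t => f '' (N' ∩ closedBall ((t : Nreg) : EuclideanSpace ℝ (Fin 3)) (r (t : Nreg)))
    with hS
  have hSclosed : ∀ j, IsClosed (S j) := by
    rintro (_ | t)
    · exact ((hN'c.inter_right hCritc).image hfc).isClosed
    · exact ((hN'c.inter_right isClosed_closedBall).image hfc).isClosed
  have hScov : Ioo c₁ c₂ ⊆ ⋃ j, S j := by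
    intro c hc
    obtain ⟨z, hzN, hzf, -⟩ := hN'surj c hc
    by_cases hzC : z ∈ Crit
    · exact mem_iUnion.2 ⟨none, ⟨z, ⟨hzN, hzC⟩, hzf⟩⟩
    · obtain ⟨t, htT, hzt⟩ := hcovreg z ⟨hzN, hzC⟩
      exact mem_iUnion.2 ⟨some ⟨t, htT⟩, ⟨z, ⟨hzN, mem_closedBall.2 (mem_ball.1 hzt).le⟩, hzf⟩⟩
  obtain ⟨j, a', b', hab', hsub⟩ := exists_Ioo_subset_of_closed_cover S hSclosed hc₁₂ hScov
  rcases j with _ | t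
  · -- an interval of critical values: impossible (Sard substitute)
    exfalso
    obtain ⟨c, hc, hregc⟩ := exists_regular_level hXfc hfd hψ0 hψ1 y₀ (R₀ + u) hab'
    obtain ⟨z, ⟨hzN, hzC⟩, hzf⟩ := (hsub hc).1
    refine hregc z hzN.1 ?_ hzf ⟨by rw [hXf0]; exact hzC.2, by rw [hXf1, hzC.1, neg_zero]⟩
    exact (dist_lt_of_infDist_lt hKne hKR (by linarith [hzN.2.1] : d z < u)).le
  · -- an interval of levels inside one null chart: the chart is dead there
    set tc : EuclideanSpace ℝ (Fin 3) := ((t : Nreg) : EuclideanSpace ℝ (Fin 3)) with htc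
    have htreg : tc ∈ Nreg := (t : Nreg).2
    have ht2 : tc 2 = y₀ 2 := htreg.1.1
    obtain ⟨hrpos, hrprop⟩ := hr tc htreg
    have hκ : ∀ c ∈ Ioo a' b', κ tc c = 0 := by
      intro c hc
      obtain ⟨z, ⟨hzN, hzball⟩, hzf⟩ := (hsub hc).1
      have hzt : dist z tc < 2 * r tc := by linarith [mem_closedBall.1 hzball]
      obtain ⟨hiff, hzreg⟩ := hrprop z hzt (hzN.1.trans ht2.symm)
      have hXz : X z = 0 := by
        rcases hzN.2.2.2 with h | h
        · exact h
        · exfalso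
          rcases hzreg with h' | h'
          · exact h' h.1
          · exact h' h.2
      rw [← hzf]; exact hiff.1 hXz
    -- a bad point at the middle level and a planar disc around it
    have hmid : (a' + b') / 2 ∈ Ioo a' b' := ⟨by linarith, by linarith⟩
    obtain ⟨z₁, ⟨hz₁N, hz₁ball⟩, hz₁f⟩ := (hsub hmid).1
    have hz₁2 : z₁ 2 = y₀ 2 := hz₁N.1
    obtain ⟨ρ₁, hρ₁, hρ₁f⟩ : ∃ ρ₁ > 0, ∀ y, dist y z₁ < ρ₁ → f y ∈ Ioo a' b' := by
      have hev : ∀ᶠ y in 𝓝 z₁, f y ∈ Ioo a' b' :=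
        hfc.continuousAt.preimage_mem_nhds (isOpen_Ioo.mem_nhds (by rw [hz₁f]; exact hmid))
      obtain ⟨ρ₁, hρ₁, hb⟩ := Metric.eventually_nhds_iff.1 hev
      exact ⟨ρ₁, hρ₁, fun y hy => hb hy⟩
    refine ⟨z₁, min (r tc) ρ₁, hz₁2, lt_min hrpos hρ₁, fun y hy2 hyd => ?_⟩
    have hyt : dist y tc < 2 * r tc := by
      have h1 : dist y z₁ < r tc := lt_of_lt_of_le hyd (min_le_left _ _)
      linarith [dist_triangle y z₁ tc, mem_closedBall.1 hz₁ball]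
    obtain ⟨hiff, -⟩ := hrprop y hyt (hy2.trans ht2.symm)
    exact hiff.2 (hκ (f y) (hρ₁f y (lt_of_lt_of_le hyd (min_le_right _ _))))

end Summit.NavierStokesRegularity.NavierStokesRegularity.Theorems.PoloidalWindowDoorPoloidalWindowRigidityIslandOrNullCore

end
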